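/-
Copyright (c) 2026 the pub-hodgecm-mathlib formalisation cell (harness21).  Prover seat hodgecm-mathlib-LH5-p03 (g2): brick (U-dy-unr) ‹U-FIN AT AN UNRAMIFIED PLACE›
for half A line LH4 (dealer LH4-plan (g3), dyadic pay-down `F0_P3c_DyadicPaydown`, organ (D-SH)); 2026-09-02.
-/
import Literature.NumberTheory.Rogawski1990.UnipotentLevelPiecesFrameCM                  -- ★ p846498: the `ψ = T·e(·)·T⁻¹` dictionary (`conj_localNonsplitEquiv_mem`, `conjClasses_mk_eq_iff_exists_conj`, `conj_localNonsplitEquiv_sub_one_pow_eq_zero`); brings ★ `UnitaryThreeUnipotentClassesUnramified` (`sq_zero_unipotent_cases`)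
import Literature.NumberTheory.Automorphic.UnitaryThreeUnipotentClassesRamifiedPlace     -- ★ p846845 (import closure identical to ★ `UnitaryThreeUnipotentClassesFiniteCM`)
import Literature.NumberTheory.Automorphic.UnitaryThreeRegularUnipotentClass             -- ★ Prop. 3.9.1 `exists_conj_eq_of_regular_unipotent` (ONE regular class, `2 ≠ 0` in characteristic `0`)
import Literature.NumberTheory.Automorphic.HyperspecialUnitaryCartanAdicCompletion       -- ★ `unramifiedLocalConjDatum_adicCompletion` (the unramified datum at an inert `w`, no residue-characteristic condition)
import Literature.NumberTheory.LocalFields.UnramifiedQuadraticNormAtInertPlaceValued     -- ★ p846530: units are norms at inert `w` (`exists_mul_galAdicCompletionMap_eq_of_valued_eq_one`), a `σ_w`-skew unit (`exists_galAdicCompletionMap_eq_neg_valued_eq_one`)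
import HarnessLib

/-!
# ‹U-FIN› at an UNRAMIFIED non-split place `v` of `L⁺` (ANY residue characteristic, dyadic included): the unipotent conjugacy classes of
# `G = U(Φ₃)(L⁺_v)` form a FINITE set (Rogawski 1990, §3.9 Proposition 3.9.1 p. 32)

Topic `NumberTheory/Rogawski1990`; namespace `Literature.NumberTheory.Rogawski1990`.  THEOREMS ONLY (no definition, no instance, no notation, no named fact, no `sorry`);
kernel lane `--supports stmt-HodgeConjecture-24833`.  Cell `pub/hodgecm-mathlib` (D-0151), crux H413 = `stmt-HodgeConjecture-24833`; half A line LH4 (closer stub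
`stub_N6ns`), DYADIC pay-down skeleton `F0_P3c_DyadicPaydown` (LH4-plan (g3), v1 0447f09394670f4b), organ (D-SH) `stub_DyShalika` at an unramified dyadic `w`;
brick (U-dy-unr) = the ‹U-FIN› input of the Shalika chain at such `w` (census `F0/P3c/LH4/LH4-p02/g2/DYADIC-CENSUS.v1.md` §1: «unramified dyadic `w` … COSMETIC»).
Sibling of ★ p849177 `UnitaryThreeUnipotentClassesFiniteCM` (`unitaryThree_unipotent_conjClasses_finite_odd`: ONE place above `v` and `2 ∈ 𝒪_w^×`), whose INERT
branch never read the parity hypothesis: the unramified datum (★ `unramifiedLocalConjDatum_adicCompletion`, «no condition on the residue characteristic»), «units are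
norms» (★ `exists_mul_galAdicCompletionMap_eq_of_valued_eq_one`) and the `σ_w`-skew UNIT (★ `exists_galAdicCompletionMap_eq_neg_valued_eq_one`, `δ = σ_w a − a`) hold at
every place of `L⁺` unramified in `L`, and the regular class (★ `exists_conj_eq_of_regular_unipotent`) only wants `2 ≠ 0` in the characteristic-`0` field `L_w`.
HONEST LABEL: HC_CM is proved only modulo the 7 printed citations (2 remaining named inputs: hLiu418 = stmt-HodgeConjecture-24832, h413 = stmt-HodgeConjecture-24833)
until rung 0 closes; this file is count-neutral (a brick for the dyadic organ (D-SH), which stays print until its chain is ★).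

WHAT.  For a CM field `L` and a finite place `v` of `L⁺` UNRAMIFIED in `L` with ONE place `w` of `L` above it (i.e. `v` inert), the set of conjugacy classes `c` of
`G = (cmDatum L 3 Φ₃).Local v = U(Φ₃)(L⁺_v)` whose members are unipotent (`(γ_c − 1)³ = 0` on the matrix `γ_c ∈ GL₃(L ⊗ L⁺_v)`) is finite:
`∃ S : Finset (ConjClasses G), ∀ c, c ∈ S ↔ (γ_c − 1)³ = 0`.  No hypothesis on the residue characteristic of `v`.
PROOF.  Word for word the inert branch of ★ `unitaryThree_unipotent_conjClasses_finite_odd`: in the one-place model `ψ = e : G ≃* U(σ_w, J₀)(L_w)` (★ `localNonsplitEquiv`,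
frame `T = 1`) a unipotent `g` is either SINGULAR (`(g − 1)² = 0`: `g = 1` or conjugate to `n(ϖδ)` or `n(δ)`, `δ` a `σ_w`-skew unit — ★ `sq_zero_unipotent_cases` over ★
`unramifiedLocalConjDatum_adicCompletion`) or REGULAR (one class, ★ `exists_conj_eq_of_regular_unipotent`); so the unipotent classes lie in a union of FOUR subsingletons.

* `unitaryThree_unipotent_conjClasses_finite_unramified` — ‹U-FIN› at an unramified inert place (statement = ★ `unitaryThree_unipotent_conjClasses_finite_odd` with
  `IsUnit (2 : 𝒪[L_w])` replaced by `Algebra.IsUnramifiedIn (𝓞 L) v.asIdeal`).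
* `unitaryThree_unipotent_conjClasses_finite_unramified_dyadic` — the same with the idle binder `¬ IsUnit (2 : 𝒪[L_w])` in front, the organ socket's spelling.

## References
* [Rogawski1990] J. D. Rogawski, *Automorphic Representations of Unitary Groups in Three Variables*, Ann. of Math. Stud. 123 (1990), §3.9 Proposition 3.9.1 p. 32;
  §1.10 p. 9 (`n(t)`, `u(x, z)`); §8.1 p. 112.
* [Serre1979] J.-P. Serre, *Local Fields*, GTM 67 (1979), Ch. V §2 Prop. 3 (units are norms, unramified — every residue characteristic).
* [PlatonovRapinchuk1994] V. Platonov, A. Rapinchuk, *Algebraic Groups and Number Theory* (1994), §5.1 (`U(J)(F_v) = U(σ_w, J)(E_w)` at a non-split place).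
-/

set_option autoImplicit false

noncomputable section

open scoped Matrix MatrixGroups Classical ValuativeRel
open NumberField IsDedekindDomain Matrix

namespace Literature.NumberTheory.Rogawski1990

open Literature.NumberTheory.Automorphic Literature.NumberTheory.Automorphic.UnitaryGroup Literature.NumberTheory.GaloisRepresentations
open Literature.NumberTheory.Automorphic.HermitianLattice Literature.NumberTheory.LocalFields.UnramifiedQuadraticNorm

/-- **‹U-FIN› AT AN UNRAMIFIED INERT PLACE (any residue characteristic) — THE UNIPOTENT CONJUGACY CLASSES OF `U(Φ₃)(L⁺_v)` FORM A FINITE SET**: for `v` unramified and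
non-split in the CM field `L` (one place `w ∣ v`), there is a finite set `S` of conjugacy classes of `G = (cmDatum L 3 Φ₃).Local v` with `c ∈ S ↔ (γ_c − 1)³ = 0`
(`γ_c = Quotient.out c` read in `GL₃(L ⊗ L⁺_v)`).  In print the classes are FOUR: `1`, the two transvection classes `[n(t)]`, `t ∈ (E⁰ ∖ 0) ∕ N E^×` (`n(ϖδ)`, `n(δ)` with
`δ` a `σ_w`-skew unit — at a dyadic unramified `w`, `δ = 2θ + 1` for `θ² + θ + u = 0`; here `δ = σ_w a − a`, ★ `exists_galAdicCompletionMap_eq_neg_valued_eq_one`), and THE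
regular class (★ `exists_conj_eq_of_regular_unipotent`, `2 ≠ 0` in characteristic `0`); so the unipotent classes sit inside a union of four subsingletons.
[cite: Rogawski1990, §3.9 Proposition 3.9.1 p. 32; §8.1 p. 112] [cite: Serre1979, Ch. V §2 Prop. 3] -/
theorem unitaryThree_unipotent_conjClasses_finite_unramified :
    ∀ (L : Type) [Field L] [NumberField L] [IsCMField L] (v : HeightOneSpectrum (𝓞 ↥(maximalRealSubfield L))) (w : UnitaryGroup.PlacesOver L v),
      Subsingleton (UnitaryGroup.PlacesOver L v) → Algebra.IsUnramifiedIn (𝓞 L) v.asIdeal →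
      ∃ S : Finset (ConjClasses ((cmDatum L 3 (Matrix.of fun i j : Fin 3 => if i.val + j.val + 1 = 3 then (1 : L) else 0)).Local v)), ∀ c : ConjClasses ((cmDatum L 3 (Matrix.of fun i j : Fin 3 => if i.val + j.val + 1 = 3 then (1 : L) else 0)).Local v),
        c ∈ S ↔ (((Quotient.out c : ((cmDatum L 3 (Matrix.of fun i j : Fin 3 => if i.val + j.val + 1 = 3 then (1 : L) else 0)).Local v)).val : GL (Fin 3) (UnitaryGroup.LocalRing L v)).val - 1) ^ 3 = 0 := by
  intro L _ _ _ v w hsub hv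
  haveI : Algebra.IsQuadraticExtension ↥(maximalRealSubfield L) L := IsCMField.isQuadraticExtension L
  -- ## 0. the place `w` is fixed by complex conjugation; the local involution `σ_w`; `2 ≠ 0` in `L_w` (characteristic `0`)
  have hw : IsCMField.complexConj L • w.1 = w.1 := smul_placesOver_eq_of_subsingleton L v (IsCMField.complexConj L) hsub w
  have hcc : IsCMField.complexConj L * IsCMField.complexConj L = 1 := AlgEquiv.ext fun y => IsCMField.complexConj_apply_apply L y
  have hσσ : ∀ x : w.1.adicCompletion L, galAdicCompletionMap (L := L) (IsCMField.complexConj L) hw (galAdicCompletionMap (L := L) (IsCMField.complexConj L) hw x) = x :=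
    galAdicCompletionMap_galAdicCompletionMap_of_smul_eq (IsCMField.complexConj L) w (IsCMField.complexConj_ne_one L) hw
  haveI : CharZero (w.1.adicCompletion L) := charZero_of_injective_algebraMap (algebraMap L _).injective
  have h2K : (2 : w.1.adicCompletion L) ≠ 0 := two_ne_zero
  -- ## 1. the one-place model `ψ = e : G → U(σ_w, J₀)(L_w)` (frame `T = 1`: `Φ₃ ⊗ 1 = J₀`)
  obtain ⟨ψ, hψ⟩ : ∃ ψ : (cmDatum L 3 (Matrix.of fun i j : Fin 3 => if i.val + j.val + 1 = 3 then (1 : L) else 0)).Local v → GL (Fin 3) (w.1.adicCompletion L), ∀ y, ψ y =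
      (1 : GL (Fin 3) (w.1.adicCompletion L)) * ((localNonsplitEquiv (IsCMField.complexConj L) (Matrix.of fun i j : Fin 3 => if i.val + j.val + 1 = 3 then (1 : L) else 0)
        (IsCMField.complexConj_ne_one L) w hw y :
        ↥(unitaryGroupOfForm (galAdicCompletionMap (L := L) (IsCMField.complexConj L) hw) (placeForm (Matrix.of fun i j : Fin 3 => if i.val + j.val + 1 = 3 then (1 : L) else 0) w.1))) :
          GL (Fin 3) (w.1.adicCompletion L)) * (1 : GL (Fin 3) (w.1.adicCompletion L))⁻¹ :=
    ⟨_, fun _ => rfl⟩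
  have hT : placeForm (Matrix.of fun i j : Fin 3 => if i.val + j.val + 1 = 3 then (1 : L) else 0) w.1 =
      formCongr (galAdicCompletionMap (L := L) (IsCMField.complexConj L) hw) (1 : GL (Fin 3) (w.1.adicCompletion L)) ((StdForm.antidiagonal 3).over (w.1.adicCompletion L)) := by
    simp only [formCongr, placeForm, Units.val_one, Matrix.map_one _ (map_zero _) (map_one _), Matrix.transpose_one, Matrix.one_mul, Matrix.mul_one, antidiagOne_map]
    exact antidiagOne_eq_over (w.1.adicCompletion L) 3
  have hψU : ∀ y, ψ y ∈ unitaryGroupOfForm (galAdicCompletionMap (L := L) (IsCMField.complexConj L) hw) ((StdForm.antidiagonal 3).over (w.1.adicCompletion L)) :=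
    fun y => by rw [hψ]; exact conj_localNonsplitEquiv_mem L _ v w hw hT y
  have hψconj : ∀ y y', ConjClasses.mk y = ConjClasses.mk y' ↔
      ∃ k : GL (Fin 3) (w.1.adicCompletion L), k ∈ unitaryGroupOfForm (galAdicCompletionMap (L := L) (IsCMField.complexConj L) hw)
        ((StdForm.antidiagonal 3).over (w.1.adicCompletion L)) ∧ k * ψ y * k⁻¹ = ψ y' :=
    fun y y' => by simp only [hψ]; exact conjClasses_mk_eq_iff_exists_conj L _ v w hw hT y y'
  have hψnil : ∀ y : (cmDatum L 3 (Matrix.of fun i j : Fin 3 => if i.val + j.val + 1 = 3 then (1 : L) else 0)).Local v,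
      (((y.val : GL (Fin 3) (UnitaryGroup.LocalRing L v)).val - 1) ^ 3) = 0 →
      (((ψ y : GL (Fin 3) (w.1.adicCompletion L)) : Matrix (Fin 3) (Fin 3) (w.1.adicCompletion L)) - 1) ^ 3 = 0 :=
    fun y hy => by rw [hψ]; exact conj_localNonsplitEquiv_sub_one_pow_eq_zero L _ v w hw hy
  have hout : ∀ c : ConjClasses ((cmDatum L 3 (Matrix.of fun i j : Fin 3 => if i.val + j.val + 1 = 3 then (1 : L) else 0)).Local v),
      ConjClasses.mk (Quotient.out c) = c := fun c => by
    rw [← ConjClasses.quotient_mk_eq_mk, Quotient.out_eq]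
  -- ## 2. the singular classes at an unramified `w`: `1`, `[n(ϖδ)]`, `[n(δ)]` — the unramified datum, «units are norms», a `σ_w`-skew unit (no residue-characteristic condition)
  obtain ⟨na, nb, hsing⟩ : ∃ na nb : GL (Fin 3) (w.1.adicCompletion L), ∀ g : GL (Fin 3) (w.1.adicCompletion L),
      g ∈ unitaryGroupOfForm (galAdicCompletionMap (L := L) (IsCMField.complexConj L) hw) ((StdForm.antidiagonal 3).over (w.1.adicCompletion L)) →
      ((g : Matrix (Fin 3) (Fin 3) (w.1.adicCompletion L)) - 1) * ((g : Matrix (Fin 3) (Fin 3) (w.1.adicCompletion L)) - 1) = 0 →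
      g = 1 ∨
        (∃ k : GL (Fin 3) (w.1.adicCompletion L), k ∈ unitaryGroupOfForm (galAdicCompletionMap (L := L) (IsCMField.complexConj L) hw)
          ((StdForm.antidiagonal 3).over (w.1.adicCompletion L)) ∧ k * g * k⁻¹ = na) ∨
        (∃ k : GL (Fin 3) (w.1.adicCompletion L), k ∈ unitaryGroupOfForm (galAdicCompletionMap (L := L) (IsCMField.complexConj L) hw)
          ((StdForm.antidiagonal 3).over (w.1.adicCompletion L)) ∧ k * g * k⁻¹ = nb) := by
    obtain ⟨ϖ, hd⟩ := unramifiedLocalConjDatum_adicCompletion (IsCMField.complexConj L) (IsCMField.complexConj_ne_one L) v w hw hv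
    have hnormU : ∀ x : w.1.adicCompletion L, galAdicCompletionMap (L := L) (IsCMField.complexConj L) hw x = x → Valued.v x = 1 →
        ∃ z : w.1.adicCompletion L, z * galAdicCompletionMap (L := L) (IsCMField.complexConj L) hw z = x := fun x hσx hvx =>
      exists_mul_galAdicCompletionMap_eq_of_valued_eq_one (IsCMField.complexConj L) v (IsCMField.complexConj_ne_one L) hcc hv w hw hσx hvx
    obtain ⟨δ, hσδ, hvδ⟩ := exists_galAdicCompletionMap_eq_neg_valued_eq_one (IsCMField.complexConj L) v (IsCMField.complexConj_ne_one L) hcc hv w hw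
    obtain ⟨n₀, hn₀⟩ := exists_units_coe_eq_cornerUnipotent' δ
    obtain ⟨n₁, hn₁⟩ := exists_units_coe_eq_cornerUnipotent' (ϖ * δ)
    exact ⟨n₁, n₀, fun g hg hsq => sq_zero_unipotent_cases (galAdicCompletionMap (L := L) (IsCMField.complexConj L) hw) hd hnormU hσδ hvδ hn₀ hn₁ hg hsq⟩
  -- ## 3. four subsingletons of `ConjClasses G`
  have hA1 : Set.Subsingleton {c : ConjClasses ((cmDatum L 3 (Matrix.of fun i j : Fin 3 => if i.val + j.val + 1 = 3 then (1 : L) else 0)).Local v) |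
      ψ (Quotient.out c) = 1} := by
    intro c hc c' hc'
    simp only [Set.mem_setOf_eq] at hc hc'
    rw [← hout c, ← hout c', hψconj]
    exact ⟨1, one_mem _, by rw [hc, hc', mul_one, inv_one, mul_one]⟩
  have hAa : Set.Subsingleton {c : ConjClasses ((cmDatum L 3 (Matrix.of fun i j : Fin 3 => if i.val + j.val + 1 = 3 then (1 : L) else 0)).Local v) |
      ∃ k : GL (Fin 3) (w.1.adicCompletion L), k ∈ unitaryGroupOfForm (galAdicCompletionMap (L := L) (IsCMField.complexConj L) hw)
        ((StdForm.antidiagonal 3).over (w.1.adicCompletion L)) ∧ k * ψ (Quotient.out c) * k⁻¹ = na} := by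
    intro c hc c' hc'
    obtain ⟨k, hk, hkc⟩ := hc
    obtain ⟨k', hk', hkc'⟩ := hc'
    rw [← hout c, ← hout c', hψconj]
    refine ⟨k'⁻¹ * k, mul_mem (inv_mem hk') hk, ?_⟩
    calc k'⁻¹ * k * ψ (Quotient.out c) * (k'⁻¹ * k)⁻¹ = k'⁻¹ * (k * ψ (Quotient.out c) * k⁻¹) * k' := by group
      _ = k'⁻¹ * (k' * ψ (Quotient.out c') * k'⁻¹) * k' := by rw [hkc, hkc']
      _ = ψ (Quotient.out c') := by group
  have hAb : Set.Subsingleton {c : ConjClasses ((cmDatum L 3 (Matrix.of fun i j : Fin 3 => if i.val + j.val + 1 = 3 then (1 : L) else 0)).Local v) |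
      ∃ k : GL (Fin 3) (w.1.adicCompletion L), k ∈ unitaryGroupOfForm (galAdicCompletionMap (L := L) (IsCMField.complexConj L) hw)
        ((StdForm.antidiagonal 3).over (w.1.adicCompletion L)) ∧ k * ψ (Quotient.out c) * k⁻¹ = nb} := by
    intro c hc c' hc'
    obtain ⟨k, hk, hkc⟩ := hc
    obtain ⟨k', hk', hkc'⟩ := hc'
    rw [← hout c, ← hout c', hψconj]
    refine ⟨k'⁻¹ * k, mul_mem (inv_mem hk') hk, ?_⟩
    calc k'⁻¹ * k * ψ (Quotient.out c) * (k'⁻¹ * k)⁻¹ = k'⁻¹ * (k * ψ (Quotient.out c) * k⁻¹) * k' := by group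
      _ = k'⁻¹ * (k' * ψ (Quotient.out c') * k'⁻¹) * k' := by rw [hkc, hkc']
      _ = ψ (Quotient.out c') := by group
  have hAr : Set.Subsingleton {c : ConjClasses ((cmDatum L 3 (Matrix.of fun i j : Fin 3 => if i.val + j.val + 1 = 3 then (1 : L) else 0)).Local v) |
      (((ψ (Quotient.out c) : GL (Fin 3) (w.1.adicCompletion L)) : Matrix (Fin 3) (Fin 3) (w.1.adicCompletion L)) - 1) ^ 3 = 0 ∧
      (((ψ (Quotient.out c) : GL (Fin 3) (w.1.adicCompletion L)) : Matrix (Fin 3) (Fin 3) (w.1.adicCompletion L)) - 1) *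
        (((ψ (Quotient.out c) : GL (Fin 3) (w.1.adicCompletion L)) : Matrix (Fin 3) (Fin 3) (w.1.adicCompletion L)) - 1) ≠ 0} := by
    intro c hc c' hc'
    obtain ⟨hn, hr⟩ := hc
    obtain ⟨hn', hr'⟩ := hc'
    rw [← hout c, ← hout c', hψconj]
    exact exists_conj_eq_of_regular_unipotent (galAdicCompletionMap (L := L) (IsCMField.complexConj L) hw) hσσ h2K (hψU _) (hψU _) ⟨3, hn⟩ ⟨3, hn'⟩ hr hr'
  -- ## 4. the unipotent classes lie in the (finite) union of the four subsingletons
  have hfin : Set.Finite {c : ConjClasses ((cmDatum L 3 (Matrix.of fun i j : Fin 3 => if i.val + j.val + 1 = 3 then (1 : L) else 0)).Local v) |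
      (((Quotient.out c : ((cmDatum L 3 (Matrix.of fun i j : Fin 3 => if i.val + j.val + 1 = 3 then (1 : L) else 0)).Local v)).val :
        GL (Fin 3) (UnitaryGroup.LocalRing L v)).val - 1) ^ 3 = 0} := by
    refine (((hA1.finite.union hAa.finite).union hAb.finite).union hAr.finite).subset ?_
    intro c hc
    have h3 := hψnil _ hc
    simp only [Set.mem_union, Set.mem_setOf_eq]
    by_cases hsq : (((ψ (Quotient.out c) : GL (Fin 3) (w.1.adicCompletion L)) : Matrix (Fin 3) (Fin 3) (w.1.adicCompletion L)) - 1) *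
        (((ψ (Quotient.out c) : GL (Fin 3) (w.1.adicCompletion L)) : Matrix (Fin 3) (Fin 3) (w.1.adicCompletion L)) - 1) = 0
    · rcases hsing _ (hψU _) hsq with h | h | h
      · exact Or.inl (Or.inl (Or.inl h))
      · exact Or.inl (Or.inl (Or.inr h))
      · exact Or.inl (Or.inr h)
    · exact Or.inr ⟨h3, hsq⟩
  exact ⟨hfin.toFinset, fun c => by rw [Set.Finite.mem_toFinset, Set.mem_setOf_eq]⟩

/-- **‹U-FIN› AT AN UNRAMIFIED DYADIC PLACE, the organ socket's spelling** — ★ `unitaryThree_unipotent_conjClasses_finite_odd`'s text with `IsUnit (2 : 𝒪[L_w])`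
replaced by `Algebra.IsUnramifiedIn (𝓞 L) v.asIdeal` AND the (idle) dyadic marker `¬ IsUnit (2 : 𝒪[L_w])`: one line over ★ `unitaryThree_unipotent_conjClasses_finite_unramified`.
[cite: Rogawski1990, §3.9 Proposition 3.9.1 p. 32] -/
theorem unitaryThree_unipotent_conjClasses_finite_unramified_dyadic :
    ∀ (L : Type) [Field L] [NumberField L] [IsCMField L] (v : HeightOneSpectrum (𝓞 ↥(maximalRealSubfield L))) (w : UnitaryGroup.PlacesOver L v),
      Subsingleton (UnitaryGroup.PlacesOver L v) → Algebra.IsUnramifiedIn (𝓞 L) v.asIdeal → ¬ IsUnit (2 : 𝒪[w.1.adicCompletion L]) →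
      ∃ S : Finset (ConjClasses ((cmDatum L 3 (Matrix.of fun i j : Fin 3 => if i.val + j.val + 1 = 3 then (1 : L) else 0)).Local v)), ∀ c : ConjClasses ((cmDatum L 3 (Matrix.of fun i j : Fin 3 => if i.val + j.val + 1 = 3 then (1 : L) else 0)).Local v),
        c ∈ S ↔ (((Quotient.out c : ((cmDatum L 3 (Matrix.of fun i j : Fin 3 => if i.val + j.val + 1 = 3 then (1 : L) else 0)).Local v)).val : GL (Fin 3) (UnitaryGroup.LocalRing L v)).val - 1) ^ 3 = 0 :=
  fun L _ _ _ v w hsub hv _ => unitaryThree_unipotent_conjClasses_finite_unramified L v w hsub hv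

end Literature.NumberTheory.Rogawski1990

end
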